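import Literature.MathematicalPhysics.QuantumFieldTheory.Balaban1983to89.B15
import Summits.QuantumFields.BalabanUV.T4Continuum.Spine.NE7.QLaCriticality

/-!
# Spine/NE7/QLaQuotientFormat — W-fmt@1, the LAW half, read on the typed (0.3) of [Balaban1989LargeFieldI]: the
# `t`-discrepancy of the logarithm of ONE large-field quotient dressed by a rider `e^{t·F}` is at most `2·|t|·s`, `s` the
# rider's range about any constant on the fibre — for UNNORMALISED positive pieces, no probability law needed

Cell `pub-balaban-gaps` (YM blitz Y1, track G2, seat `ne7`, generation 10); text of record
`run/shared/lean/pub/pub-balaban-gaps/ne/NE7.md` (v10: §4undecies, census R64).  37th `Spine/NE7/` file; 0 `def`, 0 sorry.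

WHY.  After files 5–36 the residual input of NODE S = (QL-a)∣_{U=1} is the FORMAT «W-fmt@1»: that the `t`-dependent
field-independent constants of the large-field operation at the trivial exterior are log-quotients of rider-tilted fibre laws, so
that `abs_log_integral_exp_sub_le` (file 5 :324: two PROBABILITY laws, `|G| ≤ s` a.e. ⟹ discrepancy `≤ 2·|t|·s`) applies.  The
operation is PRINTED and TYPED: [Balaban1989LargeFieldI] (0.3) p. 176, *"(𝐑ρ)(V) = Σ_Z ρ(Z″, V) ∫dV⌈_{Z′} ρ(Z, V) / ∫dV⌈_{Z′}
ρ(Z″, V)"* = `B15.Rop` over the abstract datum `B15.RData` (restricted integrals `IntOver Z′` as functionals, pieces `ρ Z`).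
This file reads the law half of W-fmt@1 ON THAT TYPED FORM, with no normalisation step: for ONE quotient, if the restricted
integral `∫dV⌈_{Z′}` (exterior variables frozen) is integration against a measure `μ` (HYPOTHESIS `hInt` — true for a restricted
product Haar measure, which `RData` does not model, B15.lean header), the two pieces `ρ(Z,·)`, `ρ(Z″,·)` are `μ`-integrable,
non-negative, with positive integrals (the printed proviso p. 176: *"the densities are positive, and the integration domains …
are nonempty, hence the denominators are positive"*), and the DRESSED pieces are `e^{t·F}·ρ(Z,·)`, `e^{t·F}·ρ(Z″,·)` with ONE
rider `F` (format fact (F-rider): the observable rider multiplies the whole density — tree node O2 `T4Spectator`: a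
renormalisation step does not see a function of the next block average, so `e^{tF∘avg^{K−k}}` rides on every piece alike) whose
range on the fibre is `|F − F₀| ≤ s` `μ`-a.e. for some constant `F₀` (the flat value `W(1) = 1`; the range is NODE S's DEFECT,
`abs_rider_le_of_support` ∕ `loopDefect_le_of_support`, on supports of the printed kind p. 196 «|V′ − 1| < O(1)M²NR_k⁴ε_k on B₀»,
census R31), THEN the quotient's logarithm moves by at most `2·|t|·s` between source `0` and source `t`
(`abs_log_tiltedQuotient_sub_le`; on `B15.RData` letter for letter: `b15_quotient_discrepancy_le`).  The proof is the sandwich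
`e^{tF₀ − |t|s}·∫ρᵢ ≤ ∫e^{tF}ρᵢ ≤ e^{tF₀ + |t|s}·∫ρᵢ` — monotonicity of the integral, nothing about the pieces beyond sign and
integrability: NO symmetry, conditional mean or covariance (the first-order channel is absent at `U = 1`, census §4ter).  §3 hands
the bound to `Spine.NE7.qla_of_defect` ∕ `qlaPt_of_defect` (file 5) as their binder `hdef`.

WHAT REMAINS OF W-fmt@1 AFTER THIS FILE (NODE O ∕ route 1's format, not NE7-own): (i) WHICH ledger — reading (a) «one constant
per quotient» is served here directly; reading (b) «one constant per localization domain of the exponentiated form (0.5)–(0.6)»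
needs the passage of the `t`-discrepancy through the exponentiation (file 36 header); (ii) the support statement feeding `s`
(R31 ∕ R43 ∕ R61); (iii) an INSTANCE of `RData` by Bałaban's densities (NODE O: 0 ∕ 1 in the tree).

HONEST FRAMING.  Real analysis of one positive quotient; every declaration is [folklore]; `hInt`, (F-rider) and the range bound
are HYPOTHESES; (0.3) is quoted as printed and used only through the tree's `B15.RData` ∕ `B15.Rop` vocabulary; nothing of
Bałaban's is asserted beyond print.  NE7 NOT proved; spine 0∕9; one fixed finite T⁴ — NOT ℝ⁴, NOT infinite volume, NOT a mass
gap, NOT Clay.  No classification word moves (R10).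
-/

noncomputable section

open MeasureTheory Finset
open scoped BigOperators

namespace Summit.QuantumFields.BalabanUV.T4Continuum.Spine.NE7

open Literature.MathematicalPhysics.QuantumFieldTheory.Balaban1983to89

/-! ## §1 One dressed positive piece: the tilted integral is sandwiched by the undressed one -/

section Piece

variable {Ω : Type*} [MeasurableSpace Ω]

/-- The dressed piece is integrable: `|e^{tF}·ρ| ≤ e^{tF₀ + |t|s}·|ρ|` a.e. [folklore] -/
theorem integrable_exp_mul_mul {μ : Measure Ω} {ρ F : Ω → ℝ} (hρ : Integrable ρ μ) (hF : AEStronglyMeasurable F μ)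
    {F₀ s : ℝ} (hb : ∀ᵐ ω ∂μ, |F ω - F₀| ≤ s) (t : ℝ) :
    Integrable (fun ω => Real.exp (t * F ω) * ρ ω) μ := by
  refine (hρ.norm.const_mul (Real.exp (t * F₀ + |t| * s))).mono' ?_ ?_
  · exact (Real.continuous_exp.comp_aestronglyMeasurable (hF.const_mul t)).mul hρ.1
  · filter_upwards [hb] with ω hω
    rw [norm_mul, Real.norm_eq_abs, abs_of_pos (Real.exp_pos _)]
    refine mul_le_mul_of_nonneg_right (Real.exp_le_exp.mpr ?_) (norm_nonneg _)
    have h1 : t * F ω = t * F₀ + t * (F ω - F₀) := by ring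
    have h2 : t * (F ω - F₀) ≤ |t| * s := by
      calc t * (F ω - F₀) ≤ |t * (F ω - F₀)| := le_abs_self _
        _ = |t| * |F ω - F₀| := abs_mul _ _
        _ ≤ |t| * s := mul_le_mul_of_nonneg_left hω (abs_nonneg t)
    linarith

/-- **THE SANDWICH**: for `ρ ≥ 0` a.e. and `|F − F₀| ≤ s` a.e.,
`e^{tF₀ − |t|s}·∫ρ ≤ ∫ e^{tF}ρ ≤ e^{tF₀ + |t|s}·∫ρ`. [folklore] -/
theorem integral_exp_mul_mul_mem_Icc {μ : Measure Ω} {ρ F : Ω → ℝ} (hρ : Integrable ρ μ) (hρ0 : 0 ≤ᵐ[μ] ρ)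
    (hF : AEStronglyMeasurable F μ) {F₀ s : ℝ} (hb : ∀ᵐ ω ∂μ, |F ω - F₀| ≤ s) (t : ℝ) :
    Real.exp (t * F₀ - |t| * s) * ∫ ω, ρ ω ∂μ ≤ ∫ ω, Real.exp (t * F ω) * ρ ω ∂μ ∧
      ∫ ω, Real.exp (t * F ω) * ρ ω ∂μ ≤ Real.exp (t * F₀ + |t| * s) * ∫ ω, ρ ω ∂μ := by
  have hi := integrable_exp_mul_mul hρ hF hb t
  have hts : ∀ᵐ ω ∂μ, |t * (F ω - F₀)| ≤ |t| * s := by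
    filter_upwards [hb] with ω hω
    rw [abs_mul]
    exact mul_le_mul_of_nonneg_left hω (abs_nonneg t)
  constructor
  · rw [← integral_const_mul]
    refine integral_mono_ae (hρ.const_mul _) hi ?_
    filter_upwards [hts, hρ0] with ω hω hρω
    refine mul_le_mul_of_nonneg_right (Real.exp_le_exp.mpr ?_) hρω
    have : t * F ω = t * F₀ + t * (F ω - F₀) := by ring
    linarith [neg_abs_le (t * (F ω - F₀))]
  · rw [← integral_const_mul]
    refine integral_mono_ae hi (hρ.const_mul _) ?_
    filter_upwards [hts, hρ0] with ω hω hρω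
    refine mul_le_mul_of_nonneg_right (Real.exp_le_exp.mpr ?_) hρω
    have : t * F ω = t * F₀ + t * (F ω - F₀) := by ring
    linarith [le_abs_self (t * (F ω - F₀))]

/-- Hence, with `∫ρ > 0`: `∫e^{tF}ρ > 0` and `|log ∫e^{tF}ρ − log ∫ρ − t·F₀| ≤ |t|·s`. [folklore] -/
theorem abs_log_integral_exp_mul_mul_sub_le {μ : Measure Ω} {ρ F : Ω → ℝ} (hρ : Integrable ρ μ) (hρ0 : 0 ≤ᵐ[μ] ρ)
    (hI : 0 < ∫ ω, ρ ω ∂μ) (hF : AEStronglyMeasurable F μ) {F₀ s : ℝ} (hb : ∀ᵐ ω ∂μ, |F ω - F₀| ≤ s) (t : ℝ) :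
    0 < ∫ ω, Real.exp (t * F ω) * ρ ω ∂μ ∧
      |Real.log (∫ ω, Real.exp (t * F ω) * ρ ω ∂μ) - Real.log (∫ ω, ρ ω ∂μ) - t * F₀| ≤ |t| * s := by
  obtain ⟨hlo, hhi⟩ := integral_exp_mul_mul_mem_Icc hρ hρ0 hF hb t
  have hpos : 0 < ∫ ω, Real.exp (t * F ω) * ρ ω ∂μ := (mul_pos (Real.exp_pos _) hI).trans_le hlo
  refine ⟨hpos, ?_⟩
  have h1 : t * F₀ - |t| * s + Real.log (∫ ω, ρ ω ∂μ) ≤ Real.log (∫ ω, Real.exp (t * F ω) * ρ ω ∂μ) := by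
    have := Real.log_le_log (mul_pos (Real.exp_pos _) hI) hlo
    rwa [Real.log_mul (Real.exp_pos _).ne' hI.ne', Real.log_exp] at this
  have h2 : Real.log (∫ ω, Real.exp (t * F ω) * ρ ω ∂μ) ≤ t * F₀ + |t| * s + Real.log (∫ ω, ρ ω ∂μ) := by
    have := Real.log_le_log hpos hhi
    rwa [Real.log_mul (Real.exp_pos _).ne' hI.ne', Real.log_exp] at this
  rw [abs_le]
  constructor <;> linarith

end Piece

/-! ## §2 One quotient: the `t`-discrepancy of its logarithm is at most twice the rider's range -/

section Quotient

variable {Ω : Type*} [MeasurableSpace Ω]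

/-- **W-fmt@1, LAW HALF, UNNORMALISED.**  Two non-negative `μ`-integrable pieces `ρ₁`, `ρ₂` with positive integrals (numerator and
denominator pieces `ρ(Z,·)`, `ρ(Z″,·)` of ONE quotient of (0.3) on the fibre `∫dV⌈_{Z′}`), ONE rider `F` on both with
`|F − F₀| ≤ s` `μ`-a.e.: `|log(∫e^{tF}ρ₁ ∕ ∫e^{tF}ρ₂) − log(∫ρ₁ ∕ ∫ρ₂)| ≤ 2·|t|·s` — the constant `t·F₀` cancels between numerator
and denominator, so only the rider's RANGE about the flat value enters (second order at `U = 1` by criticality, file 5). [folklore] -/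
theorem abs_log_tiltedQuotient_sub_le (μ : Measure Ω) {ρ₁ ρ₂ F : Ω → ℝ} (hρ₁ : Integrable ρ₁ μ) (hρ₂ : Integrable ρ₂ μ)
    (hρ₁0 : 0 ≤ᵐ[μ] ρ₁) (hρ₂0 : 0 ≤ᵐ[μ] ρ₂) (hI₁ : 0 < ∫ ω, ρ₁ ω ∂μ) (hI₂ : 0 < ∫ ω, ρ₂ ω ∂μ)
    (hF : AEStronglyMeasurable F μ) {F₀ s : ℝ} (hb : ∀ᵐ ω ∂μ, |F ω - F₀| ≤ s) (t : ℝ) :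
    |Real.log ((∫ ω, Real.exp (t * F ω) * ρ₁ ω ∂μ) / (∫ ω, Real.exp (t * F ω) * ρ₂ ω ∂μ))
        - Real.log ((∫ ω, ρ₁ ω ∂μ) / (∫ ω, ρ₂ ω ∂μ))| ≤ 2 * (|t| * s) := by
  obtain ⟨hp₁, h₁⟩ := abs_log_integral_exp_mul_mul_sub_le hρ₁ hρ₁0 hI₁ hF hb t
  obtain ⟨hp₂, h₂⟩ := abs_log_integral_exp_mul_mul_sub_le hρ₂ hρ₂0 hI₂ hF hb t
  rw [Real.log_div hp₁.ne' hp₂.ne', Real.log_div hI₁.ne' hI₂.ne']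
  rw [abs_le] at h₁ h₂ ⊢
  constructor <;> linarith [h₁.1, h₁.2, h₂.1, h₂.2]

/-- The same with TWO fibre measures (numerator and denominator integrals taken against possibly different restricted measures
`μ₁`, `μ₂` carrying the pieces as densities — the form `abs_log_integral_exp_sub_le` of file 5 generalises: there `μᵢ` are
probability laws and `ρᵢ = 1`). [folklore] -/
theorem abs_log_tiltedQuotient_sub_le₂ (μ₁ μ₂ : Measure Ω) {ρ₁ ρ₂ F : Ω → ℝ} (hρ₁ : Integrable ρ₁ μ₁)
    (hρ₂ : Integrable ρ₂ μ₂) (hρ₁0 : 0 ≤ᵐ[μ₁] ρ₁) (hρ₂0 : 0 ≤ᵐ[μ₂] ρ₂) (hI₁ : 0 < ∫ ω, ρ₁ ω ∂μ₁)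
    (hI₂ : 0 < ∫ ω, ρ₂ ω ∂μ₂) (hF₁ : AEStronglyMeasurable F μ₁) (hF₂ : AEStronglyMeasurable F μ₂) {F₀ s : ℝ}
    (hb₁ : ∀ᵐ ω ∂μ₁, |F ω - F₀| ≤ s) (hb₂ : ∀ᵐ ω ∂μ₂, |F ω - F₀| ≤ s) (t : ℝ) :
    |Real.log ((∫ ω, Real.exp (t * F ω) * ρ₁ ω ∂μ₁) / (∫ ω, Real.exp (t * F ω) * ρ₂ ω ∂μ₂))
        - Real.log ((∫ ω, ρ₁ ω ∂μ₁) / (∫ ω, ρ₂ ω ∂μ₂))| ≤ 2 * (|t| * s) := by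
  obtain ⟨hp₁, h₁⟩ := abs_log_integral_exp_mul_mul_sub_le hρ₁ hρ₁0 hI₁ hF₁ hb₁ t
  obtain ⟨hp₂, h₂⟩ := abs_log_integral_exp_mul_mul_sub_le hρ₂ hρ₂0 hI₂ hF₂ hb₂ t
  rw [Real.log_div hp₁.ne' hp₂.ne', Real.log_div hI₁.ne' hI₂.ne']
  rw [abs_le] at h₁ h₂ ⊢
  constructor <;> linarith [h₁.1, h₁.2, h₂.1, h₂.2]

/-- **THE SAME FOR `log(1 + q)`** — the form in which ONE renormalised component enters the exponentiated sum (0.5) when the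
restricted integrals factorise over components (`Σ_{Z′} Π_C q_C = Π_C (1 + q_C)`; the leading, per-component entries of reading (a)):
if two positive numbers have `|log q_t − log q_0| ≤ r` then `|log(1 + q_t) − log(1 + q_0)| ≤ r` as well (`e^{−r} ≤ q_t∕q_0 ≤ e^{r}`
gives `e^{−r} ≤ (1+q_t)∕(1+q_0) ≤ e^{r}` because `e^{r} ≥ 1`).  So the discrepancy bound `2·|t|·s` of `abs_log_tiltedQuotient_sub_le`
passes to `log(1 + quotient)` unchanged (and is in fact better by the small factor `q_0`, not recorded). [folklore] -/
theorem abs_log_one_add_sub_le {qt q0 r : ℝ} (hqt : 0 < qt) (hq0 : 0 < q0) (h : |Real.log qt - Real.log q0| ≤ r) :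
    |Real.log (1 + qt) - Real.log (1 + q0)| ≤ r := by
  have hr : 0 ≤ r := (abs_nonneg _).trans h
  rw [abs_le] at h ⊢
  have h1t : 0 < 1 + qt := by linarith
  have h10 : 0 < 1 + q0 := by linarith
  have her : 1 ≤ Real.exp r := Real.one_le_exp hr
  constructor
  · -- lower: 1 + q0 ≤ e^r (1 + qt)
    have hq : q0 ≤ Real.exp r * qt := by
      have : Real.log q0 ≤ r + Real.log qt := by linarith [h.1]
      have := Real.exp_le_exp.mpr this
      rwa [Real.exp_log hq0, Real.exp_add, Real.exp_log hqt] at this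
    have hle : 1 + q0 ≤ Real.exp r * (1 + qt) := by nlinarith
    have := Real.log_le_log h10 hle
    rw [Real.log_mul (Real.exp_pos r).ne' h1t.ne', Real.log_exp] at this
    linarith
  · -- upper: 1 + qt ≤ e^r (1 + q0)
    have hq : qt ≤ Real.exp r * q0 := by
      have : Real.log qt ≤ r + Real.log q0 := by linarith [h.2]
      have := Real.exp_le_exp.mpr this
      rwa [Real.exp_log hqt, Real.exp_add, Real.exp_log hq0] at this
    have hle : 1 + qt ≤ Real.exp r * (1 + q0) := by nlinarith
    have := Real.log_le_log h1t hle
    rw [Real.log_mul (Real.exp_pos r).ne' h10.ne', Real.log_exp] at this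
    linarith

/-- … hence for ONE dressed quotient entering as `log(1 + q)`: `|log(1 + q_t) − log(1 + q_0)| ≤ 2·|t|·s` under the hypotheses of
`abs_log_tiltedQuotient_sub_le`. [folklore] -/
theorem abs_log_one_add_tiltedQuotient_sub_le (μ : Measure Ω) {ρ₁ ρ₂ F : Ω → ℝ} (hρ₁ : Integrable ρ₁ μ)
    (hρ₂ : Integrable ρ₂ μ) (hρ₁0 : 0 ≤ᵐ[μ] ρ₁) (hρ₂0 : 0 ≤ᵐ[μ] ρ₂) (hI₁ : 0 < ∫ ω, ρ₁ ω ∂μ) (hI₂ : 0 < ∫ ω, ρ₂ ω ∂μ)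
    (hF : AEStronglyMeasurable F μ) {F₀ s : ℝ} (hb : ∀ᵐ ω ∂μ, |F ω - F₀| ≤ s) (t : ℝ) :
    |Real.log (1 + (∫ ω, Real.exp (t * F ω) * ρ₁ ω ∂μ) / (∫ ω, Real.exp (t * F ω) * ρ₂ ω ∂μ))
        - Real.log (1 + (∫ ω, ρ₁ ω ∂μ) / (∫ ω, ρ₂ ω ∂μ))| ≤ 2 * (|t| * s) := by
  obtain ⟨hp₁, -⟩ := abs_log_integral_exp_mul_mul_sub_le hρ₁ hρ₁0 hI₁ hF hb t
  obtain ⟨hp₂, -⟩ := abs_log_integral_exp_mul_mul_sub_le hρ₂ hρ₂0 hI₂ hF hb t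
  exact abs_log_one_add_sub_le (div_pos hp₁ hp₂) (div_pos hI₁ hI₂)
    (abs_log_tiltedQuotient_sub_le μ hρ₁ hρ₂ hρ₁0 hρ₂0 hI₁ hI₂ hF hb t)

end Quotient

/-! ## §3 Letter for letter on the typed (0.3): `B15.RData`, the quotient of ONE region `Z`, dressed by a rider -/

section B15Form

/-- **W-fmt@1 ON THE TYPED (0.3).**  For an abstract large-field datum `D : B15.RData` ([Balaban1989LargeFieldI] (0.2)–(0.3) p. 176 as
typed in `…Balaban1983to89.B15`), a region `Z`, and the HYPOTHESES: (`hInt`) the restricted integral `∫dV⌈_{Z′}` of the region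
`Z′ = D.Zp Z` is integration against a measure `μ` on `D.Vsp`; the pieces `ρ(Z,·)`, `ρ(Z″,·)` (`Z″ = D.Zpp Z`) are
`μ`-integrable, a.e. non-negative, with positive integrals (the printed proviso); (F-rider) the dressed pieces are `e^{t·F}·ρ(Z,·)`
and `e^{t·F}·ρ(Z″,·)` for one rider `F` with `|F − F₀| ≤ s` `μ`-a.e.  THEN the (0.3) quotient
`∫dV⌈_{Z′} ρ(Z,V) ∕ ∫dV⌈_{Z′} ρ(Z″,V)` has logarithm moving by at most `2·|t|·s` from source `0` to source `t`.  This is the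
binder `hdef` of `Spine.NE7.qla_of_defect` for the ledger entry «quotient of `Z`» once `s ≤ Cd·wt·(θ^{age})²` (NODE S's defect,
files 5∕8∕29∕33∕36). [folklore] -/
theorem b15_quotient_discrepancy_le (D : B15.RData) [MeasurableSpace D.Vsp] (Z : D.Reg) (μ : Measure D.Vsp)
    (hInt : ∀ f : D.Vsp → ℝ, D.IntOver (D.Zp Z) f = ∫ V, f V ∂μ)
    (hρ₁ : Integrable (D.ρ Z) μ) (hρ₂ : Integrable (D.ρ (D.Zpp Z)) μ) (hρ₁0 : 0 ≤ᵐ[μ] D.ρ Z)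
    (hρ₂0 : 0 ≤ᵐ[μ] D.ρ (D.Zpp Z)) (hI₁ : 0 < D.IntOver (D.Zp Z) (D.ρ Z)) (hI₂ : 0 < D.IntOver (D.Zp Z) (D.ρ (D.Zpp Z)))
    {F : D.Vsp → ℝ} (hF : AEStronglyMeasurable F μ) {F₀ s : ℝ} (hb : ∀ᵐ V ∂μ, |F V - F₀| ≤ s) (t : ℝ) :
    |Real.log (D.IntOver (D.Zp Z) (fun V => Real.exp (t * F V) * D.ρ Z V) /
          D.IntOver (D.Zp Z) (fun V => Real.exp (t * F V) * D.ρ (D.Zpp Z) V))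
        - Real.log (D.IntOver (D.Zp Z) (D.ρ Z) / D.IntOver (D.Zp Z) (D.ρ (D.Zpp Z)))| ≤ 2 * (|t| * s) := by
  simp only [hInt] at hI₁ hI₂ ⊢
  exact abs_log_tiltedQuotient_sub_le μ hρ₁ hρ₂ hρ₁0 hρ₂0 hI₁ hI₂ hF hb t

/-- **… AND INTO NODE S's CURRENCY.**  If moreover the rider's range is NODE S's defect size, `s ≤ Cd·wt·(θ^{K − j})²` (`j` the
scale of the entry, `wt` its weight; `abs_rider_le_of_support`), the entry satisfies the per-component binder of
`Spine.NE7.qlaPt_of_defect` ∕ `qla_of_defect` (file 5): `|c_t − c_0| ≤ 2·(|t|·(Cd·wt·(θ^{K−j})²))`. [folklore] -/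
theorem b15_quotient_hdef (D : B15.RData) [MeasurableSpace D.Vsp] (Z : D.Reg) (μ : Measure D.Vsp)
    (hInt : ∀ f : D.Vsp → ℝ, D.IntOver (D.Zp Z) f = ∫ V, f V ∂μ)
    (hρ₁ : Integrable (D.ρ Z) μ) (hρ₂ : Integrable (D.ρ (D.Zpp Z)) μ) (hρ₁0 : 0 ≤ᵐ[μ] D.ρ Z)
    (hρ₂0 : 0 ≤ᵐ[μ] D.ρ (D.Zpp Z)) (hI₁ : 0 < D.IntOver (D.Zp Z) (D.ρ Z)) (hI₂ : 0 < D.IntOver (D.Zp Z) (D.ρ (D.Zpp Z)))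
    {F : D.Vsp → ℝ} (hF : AEStronglyMeasurable F μ) {F₀ s : ℝ} (hb : ∀ᵐ V ∂μ, |F V - F₀| ≤ s) (t : ℝ)
    {Cd wt θ : ℝ} {K j : ℕ} (hs : s ≤ Cd * wt * (θ ^ (K - j)) ^ 2) :
    |Real.log (D.IntOver (D.Zp Z) (fun V => Real.exp (t * F V) * D.ρ Z V) /
          D.IntOver (D.Zp Z) (fun V => Real.exp (t * F V) * D.ρ (D.Zpp Z) V))
        - Real.log (D.IntOver (D.Zp Z) (D.ρ Z) / D.IntOver (D.Zp Z) (D.ρ (D.Zpp Z)))|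
      ≤ 2 * (|t| * (Cd * wt * (θ ^ (K - j)) ^ 2)) :=
  (b15_quotient_discrepancy_le D Z μ hInt hρ₁ hρ₂ hρ₁0 hρ₂0 hI₁ hI₂ hF hb t).trans
    (mul_le_mul_of_nonneg_left (mul_le_mul_of_nonneg_left hs (abs_nonneg t)) zero_le_two)

end B15Form

end Summit.QuantumFields.BalabanUV.T4Continuum.Spine.NE7

end
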